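import Summits.QuantumFields.BalabanUV.Beta.GAN24.ExplicitSourceFormLambdaShare
import Summits.QuantumFields.BalabanUV.Beta.GAN24.LambdaSlotWeightsTwoLevel

/-!
# `BalabanUV.Beta.GAN24.ExplicitSourceFormPeriodic` — binder row G-an2-4 ∕ (CONV-C), the (S) row at levels `j + 1 ≥ 1`, EXIT⊗EXIT class:
# **THE EXPLICIT SOURCE FORM `n⋆` IS BOUNDED AND `Lc`-PERIODIC ON THE DATA LATTICE — the two hypotheses `hnB` ∕ `hper` of leaf-06 g49's (δ2b)
# `TwoLevelDefectVanishing.twoLevel_defect_eq_zero` and (ε-Λ) `LambdaSlotWeightsTwoLevel.lambdaSlotSum_twoLevel_eq_zero`, IN THEIR SHAPES, for the ONE datum the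
# (S)-row socket `ExplicitSourceFormLambdaShare.moments_sigmaPair_exit_succ_of_columnPairing` is about; and the two theorems INSTANTIATED at it**
# (G-an2-4 CRUX TEAM (2), seat `b2b-balaban-gan24-p2` = road-P2 chair, gen 44, INTENT 4 = leaf-06 g49's X1 INFO I2)

NOT IN PRINT; OUR BOOKKEEPING ([folklore] `emod` ∕ block-decomposition bookkeeping BY NAME: an2's `AveragingContours.blk_add_off ∕ off_mem_box` (`x = Lc·blk x + off x`), an1∕an2's
`AxialDressingRooted.axProjAt_shift` (`Π^ρ` commutes with coarse translations), leaf-06 g49's two theorems quoted by name in §2; 0 `def`, 0 cited fact, 0 `def … : Prop`, 0 sorry).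
HONEST FRAMING (cell contract, verbatim): «discharging `BetaPertH` makes Bałaban's UV stability UNCONDITIONAL — a real constructive-QFT result; it is NOT the continuum limit and NOT
the Clay problem.»  HONEST DEPENDENCY (verbatim): «continuum YM on T⁴ ⇐ BetaPertH ∧ nine spine estimates (0/9 proved); BetaPertH ⇐ (D1) ∧ (D4) ∧ CAP+tail; G-an2-4 gates asym,
D1 and NE2/3/4.»

THE OBJECT (road-P2 g43 (5.2) ∕ g44 (ΛS), written inline exactly as there): `n⋆ l t = Π^ρ(c·Π^ρ m̃_{αβ}) l t − Lc^{−(d+1)}·𝒬_{Lc}(c·Π^ρ m̃_{αβ}) l 0·𝟙[t_l % Lc = Lc − 1]`,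
`m̃_{αβ} l x = [l=α]·Lc⁻²·(x_β % Lc) − [l=β]·Lc⁻¹·𝟙[x_β % Lc = Lc−1]·(x_α % Lc)`, `Π^ρ = axProjAt ρ Lc` (any root `ρ`; the socket uses the centred root `toSite (ctrOff (d+1) Lc)`).
* §0 [folklore] generic: **`exists_abs_le_of_blockPeriodic`** — an `L`-periodic 1-form (`n l (t + L•z) = n l t`, `1 ≤ L`) is bounded (it takes its values on the box);
  **`axProjAt_blockPeriodic`** — `Π^ρ` of an `L`-periodic form is `L`-periodic (every root).
* §1 **`edgePotentialIte_blockPeriodic`**, **`explicitPotential_blockPeriodic`**, **`explicitSourceForm_blockPeriodic`** (`n⋆ l (t + Lc•z) = n⋆ l t`, every root, every `c α β`),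
  **`exists_abs_explicitSourceForm_le`** (`∃ B, ∀ l t, |n⋆ l t| ≤ B`).
* §2 the two by-name instances at the centred root (`Lc` odd): **`twoLevel_defect_explicitSourceForm_eq_zero`** = (δ2b) `twoLevel_defect_eq_zero` at `n := n⋆` ((C2′) = 0: the
  two-level defect of the (S)-row's own datum vanishes, every `j`, every slot `(ν, y′)`, every block label `y`), **`lambdaSlotSum_twoLevel_explicitSourceForm_eq_zero`** = (ε-Λ)
  `lambdaSlotSum_twoLevel_eq_zero` at `n := n⋆` (the Λ-sector of the two-level pairing, slot sum outside, vanishes for that datum).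
Asserts NO value of any resolvent column; discharges two HYPOTHESES of leaf-06's theorems at one datum and NOTHING of `hX` itself (the W and border sectors, the `e3OfK` unfolding,
the leg-Fubini and the pin assembly remain leaf-06's (ε)∕(ζ)∕(η)); (W-γ) at levels `≥ 1` ∕ (S) ∕ (INV) ∕ (Π) NOT claimed unconditionally above level 0; NOTHING of (Q-R) ∕ (DL) ∕
(LT) ∕ «T2Shape» ∕ (hW, hWall) discharged; NEVER «G-an2-4 closed» as (CONV-C); NOT D1, NOT `BetaPertH`, NOT continuum, NOT Clay.  2026-08-23; no existing file touched.
-/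

noncomputable section

open Finset
open scoped BigOperators
open Literature.MathematicalPhysics.QuantumFieldTheory
open Literature.MathematicalPhysics.QuantumFieldTheory.Balaban1983to89
open Literature.MathematicalPhysics.QuantumFieldTheory.Balaban1983to89.Beta
open ExpKernelCalculus (Site)
open AffineAveraging (Form1 box toSite unitVec dz contourSum)
open AveragingContours (blk off off_mem_box blk_add_off shift)
open AveragingContoursRooted (ctrOff ctrOff_mem_box)
open AveragingHessianKernelsRooted (hessFFAt)
open RootedComb (axProjAt)
open KernelSpecInstance (wΦ)
open OneStepKernelFamily (KInvStep colH)
open BalabanStepJetsSucc (E2 lamCoeffK)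
open Summit.QuantumFields.BalabanUV.Beta.AxialDressingRooted (coDressKBmAt axProjAt_shift one_le_of_neZero)
open Summit.QuantumFields.BalabanUV.Beta.GAN24.TwoLevelDefectVanishing (twoLevel_defect_eq_zero)
open Summit.QuantumFields.BalabanUV.Beta.GAN24.LambdaSlotWeightsTwoLevel (lambdaSlotSum_twoLevel_eq_zero)

namespace Summit.QuantumFields.BalabanUV.Beta.GAN24.ExplicitSourceFormPeriodic

variable {d : ℕ}

/-! ## §0 Generic: a block-periodic form is bounded; `Π^ρ` preserves block-periodicity -/

/-- [folklore] **A BLOCK-PERIODIC 1-FORM IS BOUNDED**: if `n l (t + L•z) = n l t` for all `l t z` (`1 ≤ L`), then `|n l t| ≤ Σ_l Σ_{b ∈ box} |n l b|` — the form takes its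
values on the box `{0,…,L−1}^{d+1}` (`t = L·blk t + off t`, an2's `blk_add_off`). -/
theorem exists_abs_le_of_blockPeriodic {L : ℕ} (hL : 1 ≤ L) (n : Form1 (d + 1) ℝ)
    (hper : ∀ (l : Fin (d + 1)) (t z : Site (d + 1)), n l (t + (L : ℤ) • z) = n l t) :
    ∃ B : ℝ, ∀ (l : Fin (d + 1)) (t : Site (d + 1)), |n l t| ≤ B := by
  refine ⟨∑ l : Fin (d + 1), ∑ b ∈ box (d + 1) L, |n l (toSite b)|, fun l t => ?_⟩
  have ht : n l t = n l (toSite (off L t)) := by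
    rw [← hper l (toSite (off L t)) (blk L t), add_comm, blk_add_off hL t]
  rw [ht]
  calc |n l (toSite (off L t))| ≤ ∑ b ∈ box (d + 1) L, |n l (toSite b)| :=
        Finset.single_le_sum (f := fun b => |n l (toSite b)|) (fun b _ => abs_nonneg _) (off_mem_box hL t)
    _ ≤ ∑ l : Fin (d + 1), ∑ b ∈ box (d + 1) L, |n l (toSite b)| :=
        Finset.single_le_sum (f := fun l => ∑ b ∈ box (d + 1) L, |n l (toSite b)|)
          (fun l _ => Finset.sum_nonneg fun b _ => abs_nonneg _) (Finset.mem_univ l)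

/-- [folklore] **`Π^ρ` OF A BLOCK-PERIODIC FORM IS BLOCK-PERIODIC** (every root `ρ`): `axProjAt ρ L A l (t + L•z) = axProjAt ρ L A l t` — `AxialDressingRooted.axProjAt_shift`
(`Π^ρ ∘ shift (L•z) = shift (L•z) ∘ Π^ρ`) at a form fixed by the shift. -/
theorem axProjAt_blockPeriodic {L : ℕ} (hL : 1 ≤ L) (ρ : Site (d + 1)) {A : Form1 (d + 1) ℝ}
    (hA : ∀ (l : Fin (d + 1)) (t z : Site (d + 1)), A l (t + (L : ℤ) • z) = A l t) (l : Fin (d + 1)) (t z : Site (d + 1)) :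
    axProjAt ρ L A l (t + (L : ℤ) • z) = axProjAt ρ L A l t := by
  have hs : shift ((L : ℤ) • z) A = A := funext fun l' => funext fun t' => hA l' t' z
  calc axProjAt ρ L A l (t + (L : ℤ) • z) = shift ((L : ℤ) • z) (axProjAt ρ L A) l t := rfl
    _ = axProjAt ρ L (shift ((L : ℤ) • z) A) l t := by rw [axProjAt_shift ρ hL]
    _ = axProjAt ρ L A l t := by rw [hs]

/-- [folklore] The residue coordinates are block-periodic: `(t + L•z)_l % L = t_l % L`. -/
theorem apply_add_zsmul_emod {L : ℕ} (t z : Site (d + 1)) (l : Fin (d + 1)) :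
    (t + (L : ℤ) • z) l % (L : ℤ) = t l % (L : ℤ) := by
  simp only [Pi.add_apply, Pi.smul_apply, smul_eq_mul, Int.add_mul_emod_self_left]

/-! ## §1 The literal: `m̃_{αβ}`, `c·Π^ρ m̃_{αβ}` and `n⋆` are `Lc`-periodic; `n⋆` is bounded -/

section Literal

variable {Lc : ℕ}

/-- NOT IN PRINT; OUR BOOKKEEPING.  **`m̃_{αβ}` IS `Lc`-PERIODIC** (it is built from the residues `x_β % Lc`, `x_α % Lc`). -/
theorem edgePotentialIte_blockPeriodic (α β l : Fin (d + 1)) (x z : Site (d + 1)) :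
    (fun l x => (if l = α then ((Lc : ℝ) ^ 2)⁻¹ * (((x β % (Lc : ℤ) : ℤ)) : ℝ) else 0)
        - (if l = β then (Lc : ℝ)⁻¹ * (if x β % (Lc : ℤ) = (Lc : ℤ) - 1 then (1 : ℝ) else 0) * (((x α % (Lc : ℤ) : ℤ)) : ℝ) else 0)) l (x + (Lc : ℤ) • z)
      = (fun l x => (if l = α then ((Lc : ℝ) ^ 2)⁻¹ * (((x β % (Lc : ℤ) : ℤ)) : ℝ) else 0)
        - (if l = β then (Lc : ℝ)⁻¹ * (if x β % (Lc : ℤ) = (Lc : ℤ) - 1 then (1 : ℝ) else 0) * (((x α % (Lc : ℤ) : ℤ)) : ℝ) else 0)) l x := by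
  simp only [apply_add_zsmul_emod]

variable [NeZero Lc]

/-- NOT IN PRINT; OUR BOOKKEEPING.  **THE EXPLICIT POTENTIAL `c·Π^ρ m̃_{αβ}` IS `Lc`-PERIODIC** (every root `ρ`, every `c`). -/
theorem explicitPotential_blockPeriodic (ρ : Site (d + 1)) (c : ℝ) (α β l : Fin (d + 1)) (v z : Site (d + 1)) :
    (fun l v => c * axProjAt ρ Lc
        (fun l x => (if l = α then ((Lc : ℝ) ^ 2)⁻¹ * (((x β % (Lc : ℤ) : ℤ)) : ℝ) else 0)
            - (if l = β then (Lc : ℝ)⁻¹ * (if x β % (Lc : ℤ) = (Lc : ℤ) - 1 then (1 : ℝ) else 0) * (((x α % (Lc : ℤ) : ℤ)) : ℝ) else 0)) l v) l (v + (Lc : ℤ) • z)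
      = (fun l v => c * axProjAt ρ Lc
        (fun l x => (if l = α then ((Lc : ℝ) ^ 2)⁻¹ * (((x β % (Lc : ℤ) : ℤ)) : ℝ) else 0)
            - (if l = β then (Lc : ℝ)⁻¹ * (if x β % (Lc : ℤ) = (Lc : ℤ) - 1 then (1 : ℝ) else 0) * (((x α % (Lc : ℤ) : ℤ)) : ℝ) else 0)) l v) l v := by
  simp only []
  rw [axProjAt_blockPeriodic (one_le_of_neZero Lc) ρ (fun l' t' z' => edgePotentialIte_blockPeriodic α β l' t' z')]

/-- NOT IN PRINT; OUR BOOKKEEPING.  **`n⋆` IS `Lc`-PERIODIC ON THE DATA LATTICE**: `n⋆ l (t + Lc•z) = n⋆ l t` (every root `ρ`, every `c α β`) — the hypothesis `hper` of leaf-06 g49's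
`twoLevel_defect_eq_zero` ∕ `lambdaSlotSum_twoLevel_eq_zero`, in its shape, for the (S)-row's datum. -/
theorem explicitSourceForm_blockPeriodic (ρ : Site (d + 1)) (c : ℝ) (α β l : Fin (d + 1)) (t z : Site (d + 1)) :
    (axProjAt ρ Lc
        (fun l v => c * axProjAt ρ Lc
          (fun l x => (if l = α then ((Lc : ℝ) ^ 2)⁻¹ * (((x β % (Lc : ℤ) : ℤ)) : ℝ) else 0)
              - (if l = β then (Lc : ℝ)⁻¹ * (if x β % (Lc : ℤ) = (Lc : ℤ) - 1 then (1 : ℝ) else 0) * (((x α % (Lc : ℤ) : ℤ)) : ℝ) else 0)) l v) l (t + (Lc : ℤ) • z)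
      - ((Lc : ℝ) ^ (d + 1))⁻¹ * (contourSum Lc
        (fun l v => c * axProjAt ρ Lc
          (fun l x => (if l = α then ((Lc : ℝ) ^ 2)⁻¹ * (((x β % (Lc : ℤ) : ℤ)) : ℝ) else 0)
              - (if l = β then (Lc : ℝ)⁻¹ * (if x β % (Lc : ℤ) = (Lc : ℤ) - 1 then (1 : ℝ) else 0) * (((x α % (Lc : ℤ) : ℤ)) : ℝ) else 0)) l v) l 0
        * (if (t + (Lc : ℤ) • z) l % (Lc : ℤ) = (Lc : ℤ) - 1 then (1 : ℝ) else 0)))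
      = (axProjAt ρ Lc
            (fun l v => c * axProjAt ρ Lc
              (fun l x => (if l = α then ((Lc : ℝ) ^ 2)⁻¹ * (((x β % (Lc : ℤ) : ℤ)) : ℝ) else 0)
                  - (if l = β then (Lc : ℝ)⁻¹ * (if x β % (Lc : ℤ) = (Lc : ℤ) - 1 then (1 : ℝ) else 0) * (((x α % (Lc : ℤ) : ℤ)) : ℝ) else 0)) l v) l t
          - ((Lc : ℝ) ^ (d + 1))⁻¹ * (contourSum Lc
            (fun l v => c * axProjAt ρ Lc
              (fun l x => (if l = α then ((Lc : ℝ) ^ 2)⁻¹ * (((x β % (Lc : ℤ) : ℤ)) : ℝ) else 0)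
                  - (if l = β then (Lc : ℝ)⁻¹ * (if x β % (Lc : ℤ) = (Lc : ℤ) - 1 then (1 : ℝ) else 0) * (((x α % (Lc : ℤ) : ℤ)) : ℝ) else 0)) l v) l 0
            * (if t l % (Lc : ℤ) = (Lc : ℤ) - 1 then (1 : ℝ) else 0))) := by
  rw [axProjAt_blockPeriodic (one_le_of_neZero Lc) ρ (fun l' t' z' => explicitPotential_blockPeriodic ρ c α β l' t' z'),
    apply_add_zsmul_emod]

/-- NOT IN PRINT; OUR BOOKKEEPING.  **`n⋆` IS BOUNDED**: `∃ B, ∀ l t, |n⋆ l t| ≤ B` (every root, every `c α β`) — the hypothesis `hnB` of leaf-06 g49's theorems, in its shape. -/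
theorem exists_abs_explicitSourceForm_le (ρ : Site (d + 1)) (c : ℝ) (α β : Fin (d + 1)) :
    ∃ B : ℝ, ∀ (l : Fin (d + 1)) (t : Site (d + 1)),
      |(axProjAt ρ Lc
          (fun l v => c * axProjAt ρ Lc
            (fun l x => (if l = α then ((Lc : ℝ) ^ 2)⁻¹ * (((x β % (Lc : ℤ) : ℤ)) : ℝ) else 0)
                - (if l = β then (Lc : ℝ)⁻¹ * (if x β % (Lc : ℤ) = (Lc : ℤ) - 1 then (1 : ℝ) else 0) * (((x α % (Lc : ℤ) : ℤ)) : ℝ) else 0)) l v) l t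
        - ((Lc : ℝ) ^ (d + 1))⁻¹ * (contourSum Lc
          (fun l v => c * axProjAt ρ Lc
            (fun l x => (if l = α then ((Lc : ℝ) ^ 2)⁻¹ * (((x β % (Lc : ℤ) : ℤ)) : ℝ) else 0)
                - (if l = β then (Lc : ℝ)⁻¹ * (if x β % (Lc : ℤ) = (Lc : ℤ) - 1 then (1 : ℝ) else 0) * (((x α % (Lc : ℤ) : ℤ)) : ℝ) else 0)) l v) l 0
          * (if t l % (Lc : ℤ) = (Lc : ℤ) - 1 then (1 : ℝ) else 0)))| ≤ B :=
  exists_abs_le_of_blockPeriodic (one_le_of_neZero Lc) (fun l t => (axProjAt ρ Lc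
        (fun l v => c * axProjAt ρ Lc
          (fun l x => (if l = α then ((Lc : ℝ) ^ 2)⁻¹ * (((x β % (Lc : ℤ) : ℤ)) : ℝ) else 0)
              - (if l = β then (Lc : ℝ)⁻¹ * (if x β % (Lc : ℤ) = (Lc : ℤ) - 1 then (1 : ℝ) else 0) * (((x α % (Lc : ℤ) : ℤ)) : ℝ) else 0)) l v) l t
      - ((Lc : ℝ) ^ (d + 1))⁻¹ * (contourSum Lc
        (fun l v => c * axProjAt ρ Lc
          (fun l x => (if l = α then ((Lc : ℝ) ^ 2)⁻¹ * (((x β % (Lc : ℤ) : ℤ)) : ℝ) else 0)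
              - (if l = β then (Lc : ℝ)⁻¹ * (if x β % (Lc : ℤ) = (Lc : ℤ) - 1 then (1 : ℝ) else 0) * (((x α % (Lc : ℤ) : ℤ)) : ℝ) else 0)) l v) l 0
        * (if t l % (Lc : ℤ) = (Lc : ℤ) - 1 then (1 : ℝ) else 0))))
    fun l t z => explicitSourceForm_blockPeriodic ρ c α β l t z

end Literal

/-! ## §2 Leaf-06 g49's (δ2b) and (ε-Λ) at the (S)-row's datum, by name -/

section Instances

variable {Lc : ℕ} [NeZero Lc]

/-- NOT IN PRINT; OUR BOOKKEEPING.  **(C2′) = 0 FOR THE (S)-ROW's OWN DATUM**: leaf-06 g49's `TwoLevelDefectVanishing.twoLevel_defect_eq_zero` (`Lc` odd, centred root, every `j`,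
every slot `(ν, y′)` of `G_{j+1}`, every block label `y`) at `n := n⋆` (every `c α β`), its `hnB` ∕ `hper` discharged by §1. -/
theorem twoLevel_defect_explicitSourceForm_eq_zero (hLc : Odd Lc) (j : ℕ) (ν : Fin (d + 1)) (y' : Site (d + 1)) (c : ℝ) (α β : Fin (d + 1)) (y : Site (d + 1)) :
    ∑' w : Site (d + 1), ∑ μ,
      (((if blk Lc (w + unitVec μ) = y then (1 : ℝ) else 0) - (if blk Lc w = y then (1 : ℝ) else 0))
        * ((∑ b ∈ box (d + 1) Lc, ∑ s ∈ Finset.range Lc, (if Lc ≤ b μ + s then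
              (∑ l, ∑' t : Site (d + 1),
                (axProjAt (toSite (ctrOff (d + 1) Lc)) Lc
                    (fun l v => c * axProjAt (toSite (ctrOff (d + 1) Lc)) Lc
                      (fun l x => (if l = α then ((Lc : ℝ) ^ 2)⁻¹ * (((x β % (Lc : ℤ) : ℤ)) : ℝ) else 0)
                          - (if l = β then (Lc : ℝ)⁻¹ * (if x β % (Lc : ℤ) = (Lc : ℤ) - 1 then (1 : ℝ) else 0) * (((x α % (Lc : ℤ) : ℤ)) : ℝ) else 0)) l v) l t
                  - ((Lc : ℝ) ^ (d + 1))⁻¹ * (contourSum Lc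
                    (fun l v => c * axProjAt (toSite (ctrOff (d + 1) Lc)) Lc
                      (fun l x => (if l = α then ((Lc : ℝ) ^ 2)⁻¹ * (((x β % (Lc : ℤ) : ℤ)) : ℝ) else 0)
                          - (if l = β then (Lc : ℝ)⁻¹ * (if x β % (Lc : ℤ) = (Lc : ℤ) - 1 then (1 : ℝ) else 0) * (((x α % (Lc : ℤ) : ℤ)) : ℝ) else 0)) l v) l 0
                    * (if t l % (Lc : ℤ) = (Lc : ℤ) - 1 then (1 : ℝ) else 0)))
                * colH (coDressKBmAt (toSite (ctrOff (d + 1) Lc)) Lc (KInvStep (d := d) Lc j)) Lc l t μ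
                ((Lc : ℤ) • w + toSite b + (s : ℤ) • unitVec μ)) else 0))
          - (∑ b ∈ box (d + 1) Lc, ∑ s ∈ Finset.range Lc, (if b μ + s + 1 < Lc then
              (∑ l, ∑' t : Site (d + 1),
                (axProjAt (toSite (ctrOff (d + 1) Lc)) Lc
                    (fun l v => c * axProjAt (toSite (ctrOff (d + 1) Lc)) Lc
                      (fun l x => (if l = α then ((Lc : ℝ) ^ 2)⁻¹ * (((x β % (Lc : ℤ) : ℤ)) : ℝ) else 0)
                          - (if l = β then (Lc : ℝ)⁻¹ * (if x β % (Lc : ℤ) = (Lc : ℤ) - 1 then (1 : ℝ) else 0) * (((x α % (Lc : ℤ) : ℤ)) : ℝ) else 0)) l v) l t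
                  - ((Lc : ℝ) ^ (d + 1))⁻¹ * (contourSum Lc
                    (fun l v => c * axProjAt (toSite (ctrOff (d + 1) Lc)) Lc
                      (fun l x => (if l = α then ((Lc : ℝ) ^ 2)⁻¹ * (((x β % (Lc : ℤ) : ℤ)) : ℝ) else 0)
                          - (if l = β then (Lc : ℝ)⁻¹ * (if x β % (Lc : ℤ) = (Lc : ℤ) - 1 then (1 : ℝ) else 0) * (((x α % (Lc : ℤ) : ℤ)) : ℝ) else 0)) l v) l 0
                    * (if t l % (Lc : ℤ) = (Lc : ℤ) - 1 then (1 : ℝ) else 0)))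
                * colH (coDressKBmAt (toSite (ctrOff (d + 1) Lc)) Lc (KInvStep (d := d) Lc j)) Lc l t μ
                ((Lc : ℤ) • w + toSite b + (s : ℤ) • unitVec μ)) else 0)))
        * (∑' v : Site (d + 1), ∑ l : Fin (d + 1), wΦ (N := Lc ^ (j + 1)) μ l (w - v)
            * colH (coDressKBmAt (toSite (ctrOff (d + 1) Lc)) Lc (KInvStep (d := d) Lc (j + 1))) Lc ν y' l v)) = 0 := by
  obtain ⟨B, hB⟩ := exists_abs_explicitSourceForm_le (Lc := Lc) (toSite (ctrOff (d + 1) Lc)) c α β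
  exact twoLevel_defect_eq_zero
    (n := fun l t => (axProjAt (toSite (ctrOff (d + 1) Lc)) Lc
          (fun l v => c * axProjAt (toSite (ctrOff (d + 1) Lc)) Lc
            (fun l x => (if l = α then ((Lc : ℝ) ^ 2)⁻¹ * (((x β % (Lc : ℤ) : ℤ)) : ℝ) else 0)
                - (if l = β then (Lc : ℝ)⁻¹ * (if x β % (Lc : ℤ) = (Lc : ℤ) - 1 then (1 : ℝ) else 0) * (((x α % (Lc : ℤ) : ℤ)) : ℝ) else 0)) l v) l t
        - ((Lc : ℝ) ^ (d + 1))⁻¹ * (contourSum Lc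
          (fun l v => c * axProjAt (toSite (ctrOff (d + 1) Lc)) Lc
            (fun l x => (if l = α then ((Lc : ℝ) ^ 2)⁻¹ * (((x β % (Lc : ℤ) : ℤ)) : ℝ) else 0)
                - (if l = β then (Lc : ℝ)⁻¹ * (if x β % (Lc : ℤ) = (Lc : ℤ) - 1 then (1 : ℝ) else 0) * (((x α % (Lc : ℤ) : ℤ)) : ℝ) else 0)) l v) l 0
          * (if t l % (Lc : ℤ) = (Lc : ℤ) - 1 then (1 : ℝ) else 0))))
    hLc j ν y' hB (fun l t z => explicitSourceForm_blockPeriodic (toSite (ctrOff (d + 1) Lc)) c α β l t z) y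

/-- NOT IN PRINT; OUR BOOKKEEPING.  **THE Λ-SECTOR OF THE TWO-LEVEL PAIRING VANISHES FOR THE (S)-ROW's OWN DATUM**: leaf-06 g49's (ε-Λ)
`LambdaSlotWeightsTwoLevel.lambdaSlotSum_twoLevel_eq_zero` (`Lc` odd, centred root, every `j`, every slot `(ν, y′)`, every block label `y₀`) at `n := n⋆` (every `c α β`). -/
theorem lambdaSlotSum_twoLevel_explicitSourceForm_eq_zero (hLc : Odd Lc) (j : ℕ) (ν : Fin (d + 1)) (y' : Site (d + 1)) (c : ℝ) (α β : Fin (d + 1))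
    (y₀ : Site (d + 1)) :
    ∑' y : Site (d + 1), ∑ μ,
      (∑' u : Site (d + 1), ∑ κ,
          (∑ l, ∑' t : Site (d + 1),
              (axProjAt (toSite (ctrOff (d + 1) Lc)) Lc
                  (fun l v => c * axProjAt (toSite (ctrOff (d + 1) Lc)) Lc
                    (fun l x => (if l = α then ((Lc : ℝ) ^ 2)⁻¹ * (((x β % (Lc : ℤ) : ℤ)) : ℝ) else 0)
                        - (if l = β then (Lc : ℝ)⁻¹ * (if x β % (Lc : ℤ) = (Lc : ℤ) - 1 then (1 : ℝ) else 0) * (((x α % (Lc : ℤ) : ℤ)) : ℝ) else 0)) l v) l t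
                - ((Lc : ℝ) ^ (d + 1))⁻¹ * (contourSum Lc
                  (fun l v => c * axProjAt (toSite (ctrOff (d + 1) Lc)) Lc
                    (fun l x => (if l = α then ((Lc : ℝ) ^ 2)⁻¹ * (((x β % (Lc : ℤ) : ℤ)) : ℝ) else 0)
                        - (if l = β then (Lc : ℝ)⁻¹ * (if x β % (Lc : ℤ) = (Lc : ℤ) - 1 then (1 : ℝ) else 0) * (((x α % (Lc : ℤ) : ℤ)) : ℝ) else 0)) l v) l 0
                  * (if t l % (Lc : ℤ) = (Lc : ℤ) - 1 then (1 : ℝ) else 0)))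
              * colH (coDressKBmAt (toSite (ctrOff (d + 1) Lc)) Lc (KInvStep (d := d) Lc j)) Lc l t κ u)
            * (∑' x : Site (d + 1), ∑ κ₂, hessFFAt (toSite (ctrOff (d + 1) Lc)) Lc μ y u x (Sum.inl κ) (Sum.inl κ₂)
                * dz (fun z => if blk Lc (blk Lc z) = y₀ then (1 : ℝ) else 0) κ₂ x))
      * (∑' u : Site (d + 1), ∑ κ,
          (∑ l, ∑' t : Site (d + 1), colH (coDressKBmAt (toSite (ctrOff (d + 1) Lc)) Lc (KInvStep (d := d) Lc (j + 1))) Lc ν y' l t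
              * colH (coDressKBmAt (toSite (ctrOff (d + 1) Lc)) Lc (KInvStep (d := d) Lc j)) Lc l t κ u)
            * lamCoeffK (KInvStep (d := d) Lc j) (E2 d Lc j) Lc μ y κ u) = 0 := by
  obtain ⟨B, hB⟩ := exists_abs_explicitSourceForm_le (Lc := Lc) (toSite (ctrOff (d + 1) Lc)) c α β
  exact lambdaSlotSum_twoLevel_eq_zero
    (n := fun l t => (axProjAt (toSite (ctrOff (d + 1) Lc)) Lc
          (fun l v => c * axProjAt (toSite (ctrOff (d + 1) Lc)) Lc
            (fun l x => (if l = α then ((Lc : ℝ) ^ 2)⁻¹ * (((x β % (Lc : ℤ) : ℤ)) : ℝ) else 0)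
                - (if l = β then (Lc : ℝ)⁻¹ * (if x β % (Lc : ℤ) = (Lc : ℤ) - 1 then (1 : ℝ) else 0) * (((x α % (Lc : ℤ) : ℤ)) : ℝ) else 0)) l v) l t
        - ((Lc : ℝ) ^ (d + 1))⁻¹ * (contourSum Lc
          (fun l v => c * axProjAt (toSite (ctrOff (d + 1) Lc)) Lc
            (fun l x => (if l = α then ((Lc : ℝ) ^ 2)⁻¹ * (((x β % (Lc : ℤ) : ℤ)) : ℝ) else 0)
                - (if l = β then (Lc : ℝ)⁻¹ * (if x β % (Lc : ℤ) = (Lc : ℤ) - 1 then (1 : ℝ) else 0) * (((x α % (Lc : ℤ) : ℤ)) : ℝ) else 0)) l v) l 0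
          * (if t l % (Lc : ℤ) = (Lc : ℤ) - 1 then (1 : ℝ) else 0))))
    hLc j ν y' hB (fun l t z => explicitSourceForm_blockPeriodic (toSite (ctrOff (d + 1) Lc)) c α β l t z) y₀

end Instances

end Summit.QuantumFields.BalabanUV.Beta.GAN24.ExplicitSourceFormPeriodic

end
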